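import Summits.ResolutionOfSingularities.ResolutionOfSingularities.Theorems.WeightedInvariantLocalWeightedDropTameFourResidualOfCJSB

/-!
# The WHOLE tame residual T″ of the engine `LocalWeightedDrop`, priced in two explicit inputs per dimension

[OURS · L1 W4.3 · chain w43, engine crux `LocalWeightedDrop` stmt-ResolutionOfSingularities-8899, registered skeleton v28
(b8b73808bd522080), residual stub T″ `stub_tameWideApexHigherStartsWon`; res-type-088] NOT a statement of any manuscript.

With the line `tame-four-tuple-drop` the N = 4 tame residual is banked modulo ⟨F-32bR⟩ and the monomial phase (B3)
(`tameWideApexFourStartsWon_of_CJSB`).  The SAME assembly prices T″ in EVERY dimension `N = m + 2 ≥ 4`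
(`Theorems.tameWideApexHigherStartsWon_of_tupleDrop`, res-L1-w43-stub-4 p500325, + `tupleDrop_of_winsIn`, res-type-056 p504571):
the statement of T″, VERBATIM, follows from two inputs for every number `m + 1 ≥ 3` of variables —
* (TOT_m) FINITE-ROUND NC-WINNABILITY: every non-zero germ `b ∈ k⟦x₀,…,x_m⟧` is won in finitely many rounds of the count game
  with terminal predicate `GermIsNC` (`∀ b ≠ 0, ∃ n, WinsIn GermIsNC n b`) — at `m + 1 = 3` this IS the theorem
  `exists_winsIn_germIsNC_of_CJSB` modulo ⟨F-32bR⟩ (p504769); at `m + 1 ≥ 4` it is an embedded resolution statement for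
  hypersurface germs of dimension `≥ 3` in characteristic `p`, OPEN IN PRINT (the honest content of T″|₅₊);
* (MON_m) THE MONOMIAL PHASE of the tuple game in `m + 1` variables (characteristic-free combinatorics; (B3) and its generic form).
Heredity (N1) is a theorem in every dimension (`germIsNC_of_dvd_pow`).

* `tupleDrop_of_tot_of_mono` — (TOT_m) ∧ (MON_m) ⇒ `∀ e, TupleGame.Drop k (m+1) e`.
* `tameWideApexHigherStartsWon_of_tot_of_mono` — (∀ m ≥ 2, ∀ k, TOT_m ∧ MON_m) ⇒ T″ `stub_tameWideApexHigherStartsWon` VERBATIM.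
* `tameWideApexHigherStartsWon_of_CJSB_of_totFourUp_of_mono` — the same with (TOT_2) DISCHARGED by ⟨F-32bR⟩: T″ modulo
  {⟨F-32bR⟩, TOT in ≥ 4 variables (open), MON in ≥ 3 variables}.
-/

noncomputable section

open Literature.AlgebraicGeometry.Resolution

set_option linter.dupNamespace false -- mandated namespace of this single-conjunct summit

namespace Summit.ResolutionOfSingularities.ResolutionOfSingularities.Theorems.TameFourTupleDrop

variable {k : Type} [Field k]

/-- **The tuple game in `m + 1` variables from finite-round NC-winnability and the monomial phase** (heredity is free).
[OURS · L1 W4.3] -/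
theorem tupleDrop_of_tot_of_mono (m : ℕ)
    (htot : ∀ b : MvPowerSeries (Fin (m + 1)) k, b ≠ 0 → ∃ n, WinsIn GermIsNC n b)
    (hmono : ∀ e : ℕ, ∃ (β : Ordinal.{0}) (μ : (Fin (e + 1) → MvPowerSeries (Fin (m + 1)) k) → Ordinal.{0}),
      (∀ a, μ a < β) ∧
      ∀ a : Fin (e + 1) → MvPowerSeries (Fin (m + 1)) k, a ≠ 0 → TupleGame.Bad a →
        GermIsNC (TupleGame.prodSupport a) →
        TupleGame.StepDrop μ (fun b => GermIsNC (TupleGame.prodSupport b)) a) :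
    ∀ e : ℕ, TupleGame.Drop k (m + 1) e :=
  tupleDrop_of_winsIn m (fun N b d hd hnc hdvd => germIsNC_of_dvd_pow N b d hd hnc hdvd) htot hmono

/-- **T″ — THE WHOLE TAME RESIDUAL OF THE ENGINE — from (TOT_m) and (MON_m) in every number `m + 1 ≥ 3` of variables**:
the registered stub `stub_tameWideApexHigherStartsWon` of skeleton v28, statement VERBATIM. [OURS · L1 W4.3] -/
theorem tameWideApexHigherStartsWon_of_tot_of_mono
    (htot : ∀ (k : Type) [Field k] (m : ℕ), 2 ≤ m →
      ∀ b : MvPowerSeries (Fin (m + 1)) k, b ≠ 0 → ∃ n, WinsIn GermIsNC n b)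
    (hmono : ∀ (k : Type) [Field k] (m : ℕ), 2 ≤ m → ∀ e : ℕ,
      ∃ (β : Ordinal.{0}) (μ : (Fin (e + 1) → MvPowerSeries (Fin (m + 1)) k) → Ordinal.{0}),
      (∀ a, μ a < β) ∧
      ∀ a : Fin (e + 1) → MvPowerSeries (Fin (m + 1)) k, a ≠ 0 → TupleGame.Bad a →
        GermIsNC (TupleGame.prodSupport a) →
        TupleGame.StepDrop μ (fun b => GermIsNC (TupleGame.prodSupport b)) a) :
    ∀ (p : ℕ), p.Prime → ∀ (k : Type) [Field k] [CharP k p] [IsAlgClosed k]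
    (n : ℕ), (∀ m : ℕ, m < n + 4 → ∀ g : MvPowerSeries (Fin m) k,
      CobordantGame.IsSingular k g → CobordantGame.Won k m g) →
    ∀ (f : MvPowerSeries (Fin (n + 4)) k), CobordantGame.IsSingular k f →
    (∀ g : MvPowerSeries (Fin (n + 4)) k, CobordantGame.IsSingular k g → g.order < f.order →
      CobordantGame.Won k (n + 4) g) →
    ∀ (d : ℕ), f.order = d → ¬ p ∣ d →
    (∃ ℓ : Fin (n + 4) → k, ∀ i j : Fin (n + 4),
      MvPowerSeries.coeff (Finsupp.single i 1 + Finsupp.single j 1) f =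
        MvPowerSeries.coeff (Finsupp.single i 1 + Finsupp.single j 1)
          ((∑ l, MvPowerSeries.C (ℓ l) * MvPowerSeries.X l) ^ 2)) →
    (2 < d → ∃ c₁ c₂ : Fin (n + 4) → k, (∀ α β : k, α • c₁ + β • c₂ = 0 → α = 0 ∧ β = 0) ∧
      (∀ v : Fin (n + 4) → k, CobordantChart.initEval (fun _ : Fin (n + 4) => 1) (v + c₁) d f =
        CobordantChart.initEval (fun _ : Fin (n + 4) => 1) v d f) ∧
      (∀ v : Fin (n + 4) → k, CobordantChart.initEval (fun _ : Fin (n + 4) => 1) (v + c₂) d f =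
        CobordantChart.initEval (fun _ : Fin (n + 4) => 1) v d f)) →
    CobordantGame.Won k (n + 4) f := by
  refine tameWideApexHigherStartsWon_of_tupleDrop fun p hp k _ _ _ m e hm => ?_
  obtain ⟨m', rfl⟩ : ∃ m', m = m' + 1 := ⟨m - 1, by omega⟩
  exact tupleDrop_of_tot_of_mono m' (htot k m' (by omega)) (hmono k m' (by omega)) e

/-- **T″ modulo ⟨F-32bR⟩, finite-round NC-winnability in `≥ 4` variables (OPEN IN PRINT: embedded resolution of hypersurface
germs of dimension `≥ 3`), and the monomial phase in `≥ 3` variables** — the honest price of the whole tame residual: the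
three-variable totality is DISCHARGED by `exists_winsIn_germIsNC_of_CJSB` (p504769). [OURS · L1 W4.3] -/
theorem tameWideApexHigherStartsWon_of_CJSB_of_totFourUp_of_mono (hCJS : CossartJannsenSaito2020EmbeddedSequenceB.{0})
    (htot4 : ∀ (k : Type) [Field k] (m : ℕ), 3 ≤ m →
      ∀ b : MvPowerSeries (Fin (m + 1)) k, b ≠ 0 → ∃ n, WinsIn GermIsNC n b)
    (hmono : ∀ (k : Type) [Field k] (m : ℕ), 2 ≤ m → ∀ e : ℕ,
      ∃ (β : Ordinal.{0}) (μ : (Fin (e + 1) → MvPowerSeries (Fin (m + 1)) k) → Ordinal.{0}),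
      (∀ a, μ a < β) ∧
      ∀ a : Fin (e + 1) → MvPowerSeries (Fin (m + 1)) k, a ≠ 0 → TupleGame.Bad a →
        GermIsNC (TupleGame.prodSupport a) →
        TupleGame.StepDrop μ (fun b => GermIsNC (TupleGame.prodSupport b)) a) :
    ∀ (p : ℕ), p.Prime → ∀ (k : Type) [Field k] [CharP k p] [IsAlgClosed k]
    (n : ℕ), (∀ m : ℕ, m < n + 4 → ∀ g : MvPowerSeries (Fin m) k,
      CobordantGame.IsSingular k g → CobordantGame.Won k m g) →
    ∀ (f : MvPowerSeries (Fin (n + 4)) k), CobordantGame.IsSingular k f →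
    (∀ g : MvPowerSeries (Fin (n + 4)) k, CobordantGame.IsSingular k g → g.order < f.order →
      CobordantGame.Won k (n + 4) g) →
    ∀ (d : ℕ), f.order = d → ¬ p ∣ d →
    (∃ ℓ : Fin (n + 4) → k, ∀ i j : Fin (n + 4),
      MvPowerSeries.coeff (Finsupp.single i 1 + Finsupp.single j 1) f =
        MvPowerSeries.coeff (Finsupp.single i 1 + Finsupp.single j 1)
          ((∑ l, MvPowerSeries.C (ℓ l) * MvPowerSeries.X l) ^ 2)) →
    (2 < d → ∃ c₁ c₂ : Fin (n + 4) → k, (∀ α β : k, α • c₁ + β • c₂ = 0 → α = 0 ∧ β = 0) ∧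
      (∀ v : Fin (n + 4) → k, CobordantChart.initEval (fun _ : Fin (n + 4) => 1) (v + c₁) d f =
        CobordantChart.initEval (fun _ : Fin (n + 4) => 1) v d f) ∧
      (∀ v : Fin (n + 4) → k, CobordantChart.initEval (fun _ : Fin (n + 4) => 1) (v + c₂) d f =
        CobordantChart.initEval (fun _ : Fin (n + 4) => 1) v d f)) →
    CobordantGame.Won k (n + 4) f := by
  refine tameWideApexHigherStartsWon_of_tot_of_mono (fun k _ m hm => ?_) hmono
  rcases Nat.lt_or_ge m 3 with h3 | h3
  · obtain rfl : m = 2 := by omega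
    intro b hb
    exact exists_winsIn_germIsNC_of_CJSB hCJS b hb
  · exact htot4 k m h3

end Summit.ResolutionOfSingularities.ResolutionOfSingularities.Theorems.TameFourTupleDrop

end
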